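import Summits.RiemannHypothesis.RiemannHypothesis.Theorems.JensenLogBandArcTransformEstimate
import Summits.RiemannHypothesis.RiemannHypothesis.Theorems.JensenLogBandFarZoneCompetitor
import Summits.RiemannHypothesis.RiemannHypothesis.Theorems.JensenLogBandShellRegime
import Summits.RiemannHypothesis.RiemannHypothesis.Theorems.JensenLogBandShellFarNumerics
import Summits.RiemannHypothesis.RiemannHypothesis.Theorems.JensenLogBandArcSaddle
import Summits.RiemannHypothesis.RiemannHypothesis.Theorems.JensenLogBandArcDensityDeriv
import Literature.Analysis.InverseSpectral.HelicalFunctionProofsLattice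
import Literature.Probability.LatticeModels.ImprovedTreeDiagramBoundProofs
import Literature.NumberTheory.LFunctions.ZetaClassicalRegionBounds
import HarnessLib

/-!
# Pieces for the far zone of the top shell (BAND crux `XiDerivBandRealAllRates`, `stub_shellFar`)

RH ladder column JENSEN, rung J-P(P3) «log band», BAND crux `XiDerivBandRealAllRates`
(stmt-RiemannHypothesis-19913) of route «JensenLogBand», line «band-one-window» (u-arc, top-shell
reshape), lead rh-jensen-prover g8. Small real-variable lemmas kept out of the main proof of
`stub_shellFar` (`Theorems/JensenLogBandShellFar.lean`) so that its context stays light: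
sup × length for a half-arc transform, `‖ζ‖ ≥ (σ−1)/σ ≥ a₀` at the window, `(π/‖w‖)^{1/2} ≥ 2/√k`,
`η ≤ 1/50`, `log(T+y) ≤ 1+4k`, the gain `e^{−(σ−1−δ)(ℓ/2−1)} ≤ 2e^{−7a₀k/4}`, the three bracket
bounds (flank, bridge, competitor), the choice `δc = max a₀ (h−½−a)`, positivity of the peak, and the
abstract comparison `far_dominance_core`. RH-FREE. WHAT THIS IS NOT: nothing here bears on zeros of
`ζ` off the line or the truth of RH.
-/

noncomputable section

-- single-problem summit: `Summit.RiemannHypothesis.RiemannHypothesis.…` is the tree convention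
set_option linter.dupNamespace false

open Complex Real Set MeasureTheory intervalIntegral

namespace Summit.RiemannHypothesis.RiemannHypothesis.Theorems.JensenPolynomials.LogBandArc

open Literature.NumberTheory.LFunctions

/-! ## Small real-variable pieces (kept out of the main proof to keep its context light) -/

/-- **Sup × length** for a right half-arc transform: a pointwise bound `B` on `|θ| ≤ π/2` gives
`‖U_{n,h}(c)‖ ≤ (n!/2π)·(π·B)`. [folklore] -/
theorem norm_xiSqArcU_le_of_arc_bound (n : ℕ) (h : ℝ) (c : ℂ) {B : ℝ}
    (hB : ∀ θ : ℝ, |θ| ≤ Real.pi / 2 → ‖arcIntegrandU n h c θ‖ ≤ B) :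
    ‖xiSqArcU n h c‖ ≤ (n.factorial : ℝ) / (2 * π) * (π * B) := by
  rw [xiSqArcU, norm_mul]
  have hnf : ‖(n.factorial : ℂ) / (2 * π * I)‖ = (n.factorial : ℝ) / (2 * π) := by
    rw [norm_div, Complex.norm_natCast, norm_mul, norm_mul, Complex.norm_ofNat, Complex.norm_real,
      Real.norm_eq_abs, abs_of_pos Real.pi_pos, Complex.norm_I, mul_one]
  rw [hnf]
  refine mul_le_mul_of_nonneg_left ?_ (by positivity)
  have hint := intervalIntegral.norm_integral_le_of_norm_le_const (a := -(π / 2)) (b := π / 2) (C := B)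
    (f := arcIntegrandU n h c) ?_
  · have : |π / 2 - -(π / 2)| = π := by
      rw [abs_of_nonneg (by linarith [Real.pi_pos])]; ring
    rw [this] at hint
    linarith [hint]
  · intro θ hθ
    rw [uIoc_of_le (by linarith [Real.pi_pos])] at hθ
    exact hB θ (abs_le.2 ⟨by linarith [hθ.1], hθ.2⟩)

/-- `a₀ ≤ ‖ζ(½+u)‖` when `Re(½+u) ≥ 1 + 2a₀`, `0 < a₀ ≤ 1/28`. [folklore] -/
theorem zeta_window_lower {a₀ : ℝ} {u : ℂ} (ha₀ : 0 < a₀) (ha₀1 : a₀ ≤ 1 / 28)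
    (hσ : 1 + 2 * a₀ ≤ (1 / 2 + u).re) : a₀ ≤ ‖riemannZeta (1 / 2 + u)‖ := by
  have hσ1 : 1 < (1 / 2 + u).re := by linarith
  have h1 := ZetaClassicalRegion.norm_riemannZeta_ge_of_one_lt_re hσ1
  have h2 : a₀ ≤ ((1 / 2 + u).re - 1) / (1 / 2 + u).re := by
    rw [le_div_iff₀ (by linarith)]
    have h3 : (1 + 2 * a₀) * (1 - a₀) ≤ (1 / 2 + u).re * (1 - a₀) :=
      mul_le_mul_of_nonneg_right hσ (by linarith)
    nlinarith [h3, ha₀, ha₀1]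
  exact h2.trans h1

/-- `2/√k ≤ (π/‖w‖)^{1/2}` when `Re w ≥ 11k/40`, `‖w‖ ≤ 29k/40`, `k ≥ 1`. [folklore] -/
theorem main_factor_ge {k : ℕ} {w : ℂ} (hk : 1 ≤ (k : ℝ)) (hwre : 11 / 40 * (k : ℝ) ≤ w.re)
    (hwn : ‖w‖ ≤ 29 / 40 * k) : 2 / Real.sqrt k ≤ (π / ‖w‖) ^ (1 / 2 : ℝ) := by
  have hk0 : (0 : ℝ) < k := by linarith
  have hw_pos : 0 < ‖w‖ := by
    have : 0 < w.re := by linarith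
    exact lt_of_lt_of_le this ((le_abs_self _).trans (Complex.abs_re_le_norm w))
  rw [← Real.sqrt_eq_rpow]
  have h1 : 2 / Real.sqrt k = Real.sqrt (4 / k) := by
    rw [Real.sqrt_div (by norm_num), show (4 : ℝ) = 2 ^ 2 by norm_num, Real.sqrt_sq (by norm_num)]
  rw [h1]
  apply Real.sqrt_le_sqrt
  rw [div_le_div_iff₀ hk0 hw_pos]
  have h3k : 3 * (k : ℝ) ≤ π * k := mul_le_mul_of_nonneg_right Real.pi_gt_three.le hk0.le
  linarith

/-- `η = (r/160)·e^{r/160} ≤ 1/50` (and `≥ 0`) for `0 ≤ r ≤ 1`. [folklore] -/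
theorem eta_small {r a₀ : ℝ} (hr0 : 0 ≤ r) (hr1 : r ≤ 1) (ha₀ : 0 < a₀) :
    0 ≤ r * (a₀ / 160) / a₀ * Real.exp (r * (a₀ / 160) / a₀) ∧
      r * (a₀ / 160) / a₀ * Real.exp (r * (a₀ / 160) / a₀) ≤ 1 / 50 := by
  refine ⟨by positivity, ?_⟩
  have hη : r * (a₀ / 160) / a₀ = r / 160 := by field_simp
  rw [hη]
  have hx1 : |r / 160| ≤ 1 := by rw [abs_le]; constructor <;> linarith
  have he := (abs_le.1 (Real.abs_exp_sub_one_le hx1)).2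
  have hr160 : |r / 160| ≤ 1 / 160 := by rw [abs_le]; constructor <;> linarith
  have hexp : Real.exp (r / 160) ≤ 2 := by linarith
  have : r / 160 * Real.exp (r / 160) ≤ 1 / 160 * 2 :=
    mul_le_mul (by linarith) hexp (Real.exp_pos _).le (by norm_num)
  linarith

/-- `log(T + y) ≤ 1 + 4k` for `0 ≤ y ≤ 2`, `T ≥ 100`, `T < e^{ck/2}`, `c < 8`. [folklore] -/
theorem log_height_le {T c y : ℝ} {k : ℕ} (hT : 100 ≤ T) (hThi : T < Real.exp (c * k / 2))
    (hc8 : c < 8) (hy0 : 0 ≤ y) (hy2 : y ≤ 2) : Real.log (T + y) ≤ 1 + 4 * k := by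
  have hT0 : 0 < T := by linarith
  have h0 : Real.log (T + y) ≤ Real.log (2 * T) := Real.log_le_log (by linarith) (by linarith)
  have h1 : Real.log T < c * k / 2 := by
    rw [Real.log_lt_iff_lt_exp hT0]; exact hThi
  rw [Real.log_mul (by norm_num) hT0.ne'] at h0
  have h2 := Literature.Probability.LatticeModels.log_two_le_one
  have hkk : (0 : ℝ) ≤ k := Nat.cast_nonneg k
  have hck : c * k ≤ 8 * k := mul_le_mul_of_nonneg_right hc8.le hkk
  linarith

/-- The gain: `e^{−(σ−1−δ')(ℓ/2−1)} ≤ 2e^{−(7a₀/4)k}` when `σ − 1 − δ' ≥ a₀`, `ℓ ≥ c(k−1)/2 − 3`,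
`ℓ ≥ 2`, `c ≥ 7`, `0 ≤ a₀ ≤ 1/28`. [folklore] -/
theorem gain_exp_le {a₀ σ δ' ℓ c : ℝ} {k : ℕ} (ha₀ : 0 ≤ a₀) (ha₀1 : a₀ ≤ 1 / 28) (hc : 7 ≤ c)
    (hk : (1 : ℝ) ≤ k) (hℓlo : c * ((k : ℝ) - 1) / 2 - 3 ≤ ℓ) (hℓ2 : 2 ≤ ℓ)
    (hσ : a₀ ≤ σ - (1 + δ')) :
    Real.exp (-((σ - (1 + δ')) * (ℓ / 2 - 1))) ≤ 2 * Real.exp (-(7 * a₀ / 4 * k)) := by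
  have hpos : 0 ≤ ℓ / 2 - 1 := by linarith
  have h1 : Real.exp (-((σ - (1 + δ')) * (ℓ / 2 - 1))) ≤ Real.exp (-(a₀ * (ℓ / 2 - 1))) := by
    apply Real.exp_le_exp.2
    have := mul_le_mul_of_nonneg_right hσ hpos
    linarith
  exact h1.trans (exp_decay_of_gain ha₀ ha₀1 hc hk hℓlo)

/-- A product bound `672·L·e^{t}·g ≤ 672·(1+4k)·e^{14}·G` from `L ≤ 1+4k`, `t ≤ 14`, `g ≤ G`.
[folklore] -/
theorem triple_product_le {L t g G : ℝ} {k : ℕ} (hL : L ≤ 1 + 4 * k) (ht : t ≤ 14)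
    (hg0 : 0 ≤ g) (hg : g ≤ G) :
    672 * L * Real.exp t * g ≤ 672 * (1 + 4 * k) * Real.exp 14 * G := by
  have he : Real.exp t ≤ Real.exp 14 := Real.exp_le_exp.2 ht
  have h1 : 672 * L * Real.exp t ≤ 672 * (1 + 4 * k) * Real.exp 14 :=
    mul_le_mul (mul_le_mul_of_nonneg_left hL (by norm_num)) he (Real.exp_pos _).le (by positivity)
  exact mul_le_mul h1 hg hg0 (by positivity)

/-- The flank bracket bound. [folklore] -/
theorem flank_bracket_le {k : ℕ} {a₀ h L σ ℓ G : ℝ} (ha₀ : 0 < a₀) (ha₀1 : a₀ ≤ 1 / 28)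
    (hh1 : h ≤ 3 / 5) (hL : L ≤ 1 + 4 * k)
    (hG : Real.exp (-((σ - (1 + a₀)) * (ℓ / 2 - 1))) ≤ G) :
    Real.exp (12 * h + 6) * (1 + 1 / a₀) * Real.exp (-(((k : ℝ) + 1) * (1 - Real.cos (a₀ / 160)))) +
        672 * L * Real.exp (2 * h + 1) * Real.exp (-((σ - (1 + a₀)) * (ℓ / 2 - 1))) ≤
      Real.exp 14 * (1 + 1 / a₀) * Real.exp (-((a₀ / 160) ^ 2 / 4 * k)) +
        672 * (1 + 4 * k) * Real.exp 14 * G := by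
  have ha₀inv : 0 ≤ 1 + 1 / a₀ := by have := one_div_pos.2 ha₀; linarith
  have h1 : Real.exp (-(((k : ℝ) + 1) * (1 - Real.cos (a₀ / 160)))) ≤
      Real.exp (-((a₀ / 160) ^ 2 / 4 * k)) := by
    apply Real.exp_le_exp.2
    have hc' := Literature.Analysis.InverseSpectral.sq_div_four_le_one_sub_cos
      (y := a₀ / 160) (abs_le.2 ⟨by linarith, by linarith⟩)
    have hk0' : (0 : ℝ) ≤ (k : ℝ) + 1 := by positivity
    have h1 := mul_le_mul_of_nonneg_left hc' hk0'
    nlinarith [sq_nonneg (a₀ / 160), h1]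
  have h2 : Real.exp (12 * h + 6) * (1 + 1 / a₀) * Real.exp (-(((k : ℝ) + 1) * (1 - Real.cos (a₀ / 160)))) ≤
      Real.exp 14 * (1 + 1 / a₀) * Real.exp (-((a₀ / 160) ^ 2 / 4 * k)) :=
    mul_le_mul (mul_le_mul_of_nonneg_right (Real.exp_le_exp.2 (by linarith)) ha₀inv) h1
      (Real.exp_pos _).le (by positivity)
  have h3 := triple_product_le (k := k) hL (by linarith : 2 * h + 1 ≤ 14) (Real.exp_pos _).le hG
  linarith

/-- The bridge bracket bound (`|h − r| ≤ 1`, `1/r ≤ 4`). [folklore] -/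
theorem bridge_bracket_le {k : ℕ} {a₀ h r d L σ ℓ G : ℝ} (hh1 : h ≤ 3 / 5) (hr : 0 < r)
    (hrinv : 1 / r ≤ 4) (hd1 : d ≤ 1) (hL0 : 0 ≤ L) (hL : L ≤ 1 + 4 * k)
    (hG : Real.exp (-((σ - (1 + a₀)) * (ℓ / 2 - 1))) ≤ G) :
    d * (2 * (672 * L * Real.exp (2 * h + 11) * Real.exp (-((σ - (1 + a₀)) * (ℓ / 2 - 1)))) / r) ≤
      2 * (672 * (1 + 4 * k) * Real.exp 14 * G) * 4 := by
  have h3 := triple_product_le (k := k) hL (by linarith : 2 * h + 11 ≤ 14) (Real.exp_pos _).le hG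
  have hX0 : 0 ≤ 672 * L * Real.exp (2 * h + 11) * Real.exp (-((σ - (1 + a₀)) * (ℓ / 2 - 1))) := by
    positivity
  have hq : 2 * (672 * L * Real.exp (2 * h + 11) * Real.exp (-((σ - (1 + a₀)) * (ℓ / 2 - 1)))) / r ≤
      2 * (672 * (1 + 4 * k) * Real.exp 14 * G) * 4 := by
    rw [div_eq_mul_one_div]
    calc _ ≤ 2 * (672 * (1 + 4 * k) * Real.exp 14 * G) * (1 / r) :=
          mul_le_mul_of_nonneg_right (by linarith) (by positivity)
      _ ≤ _ := mul_le_mul_of_nonneg_left hrinv (by linarith)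
  have hq0 : 0 ≤ 2 * (672 * L * Real.exp (2 * h + 11) *
      Real.exp (-((σ - (1 + a₀)) * (ℓ / 2 - 1)))) / r := by positivity
  calc _ ≤ 1 * (2 * (672 * L * Real.exp (2 * h + 11) *
        Real.exp (-((σ - (1 + a₀)) * (ℓ / 2 - 1)))) / r) := mul_le_mul_of_nonneg_right hd1 hq0
    _ ≤ _ := by rw [one_mul]; exact hq

/-- The competitor bracket bound. [folklore] -/
theorem competitor_bracket_le {k : ℕ} {h L σ δ ℓ G : ℝ} (hh1 : h ≤ 3 / 5)
    (hL : L ≤ 1 + 4 * k) (hG : Real.exp (-((σ - (1 + δ)) * (ℓ / 2 - 1))) ≤ G) :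
    672 * L * Real.exp (4 * h + 9) * Real.exp (-((σ - (1 + δ)) * (ℓ / 2 - 1))) ≤
      672 * (1 + 4 * k) * Real.exp 14 * G :=
  triple_product_le (k := k) hL (by linarith : 4 * h + 9 ≤ 14) (Real.exp_pos _).le hG

/-- The far-zone choice `δc = max a₀ (h − ½ − a)`: positivity, `≤ 1`, the competitor's arc is left
of `1 + δc`, the own window is right of `1 + δc` with margin `a₀`. [folklore] -/
theorem far_deltas {a₀ a h R ε : ℝ} (ha₀ : 0 < a₀) (ha₀1 : a₀ ≤ 1 / 28) (ha : a₀ < a)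
    (hh : 1 / 2 + 2 * a₀ < h) (hh1 : h ≤ 3 / 5) (hR : h - ε ≤ R) (hε : ε ≤ a₀ / 10) :
    0 < max a₀ (h - 1 / 2 - a) ∧ max a₀ (h - 1 / 2 - a) ≤ 1 ∧
      1 / 2 + -a + h ≤ 1 + max a₀ (h - 1 / 2 - a) ∧
      1 + max a₀ (h - 1 / 2 - a) ≤ 1 / 2 + a + R ∧
      a₀ ≤ 1 / 2 + a + R - (1 + max a₀ (h - 1 / 2 - a)) := by
  have hm : max a₀ (h - 1 / 2 - a) ≤ 1 / 2 + a + R - 1 - a₀ :=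
    max_le (by linarith) (by linarith)
  refine ⟨lt_of_lt_of_le ha₀ (le_max_left _ _), max_le (by linarith) (by linarith), ?_, ?_, ?_⟩
  · have := le_max_right a₀ (h - 1 / 2 - a); linarith
  · linarith
  · linarith

/-- The saddle value of the model integrand is nonzero. [folklore] -/
theorem arcModelIntegrand_saddle_norm_pos {n : ℕ} {x T : ℝ} {u : ℂ} (hx : |x| ≤ 1 / 2)
    (hT : 100 ≤ T) (hh : 1 / 2 ≤ bandRadius n T) (hhT : bandRadius n T ≤ 7 / 20 * T)
    (hu : ‖u - ((x : ℂ) + (T : ℂ) * I + bandRadius n T)‖ ≤ 3 / 5 * bandRadius n T)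
    (hre : 0 < (u - ((x : ℂ) + (T : ℂ) * I)).re) (hσ : 1 < (1 / 2 + u).re) :
    0 < ‖arcModelIntegrand n ‖u - ((x : ℂ) + (T : ℂ) * I)‖ ((x : ℂ) + (T : ℂ) * I)
      (Complex.arg (u - ((x : ℂ) + (T : ℂ) * I)))‖ := by
  rw [arcModelIntegrand_eq_I_mul_arcDensity, circleMap_norm_arg, norm_mul, Complex.norm_I, one_mul,
    norm_pos_iff]
  obtain ⟨-, -, -, -, -, -, hnu_lo, -, -, hnuc⟩ := disc_geometry hx hT hh hhT hu
  refine arcDensity_ne_zero n (by linarith) ?_ ?_ ?_ ?_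
  · intro h0; rw [h0] at hσ; simp at hσ
  · intro h0; rw [h0, norm_zero] at hnu_lo; linarith
  · intro h0; rw [h0, sub_self] at hre; simp at hre
  · intro h0; rw [h0, norm_zero] at hnuc; linarith

/-- **The far-zone comparison, abstractly.** If the competitor is `≤ N·π·K·I`, the own transform is
within `N·I·(Z W + π F + d V)` of a main term of size `N·I·Z·s`, and `s ≥ 2/q`, `Z ≥ a₀ > 0`,
`W ≤ 1/q`, `πF + dV + πK ≤ a₀/(2q)` (`q = √k > 0`), then the competitor is strictly smaller.
[folklore] -/
theorem far_dominance_core {N I Z s W F V K d Um Up Mn a₀ q : ℝ} (hN : 0 < N) (hI : 0 < I)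
    (hq : 0 < q) (ha₀ : 0 < a₀) (hUm : Um ≤ N * (Real.pi * (K * I)))
    (hgap : Mn - Up ≤ N * (I * (Z * W + Real.pi * F + d * V))) (hMn : Mn = N * (I * Z * s))
    (hs : 2 / q ≤ s) (hZ : a₀ ≤ Z) (hW : W ≤ 1 / q)
    (hJ : Real.pi * F + d * V + Real.pi * K ≤ a₀ / (2 * q)) : Um < Up := by
  have hZ0 : 0 ≤ Z := le_trans ha₀.le hZ
  have hsW : 1 / q ≤ s - W := by
    have : 1 / q + 1 / q = 2 / q := by ring
    linarith
  have hZsW : a₀ * (1 / q) ≤ Z * (s - W) := mul_le_mul hZ hsW (by positivity) hZ0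
  have h1 : a₀ / q = a₀ * (1 / q) := by ring
  have h2 : a₀ / q = a₀ / (2 * q) + a₀ / (2 * q) := by field_simp; ring
  have hUp : N * (I * (Z * s - (Z * W + Real.pi * F + d * V))) ≤ Up := by
    have : N * (I * Z * s) - N * (I * (Z * W + Real.pi * F + d * V)) =
        N * (I * (Z * s - (Z * W + Real.pi * F + d * V))) := by ring
    linarith
  have hcore : Real.pi * (K * I) < I * (Z * s - (Z * W + Real.pi * F + d * V)) := by
    have h5 : Real.pi * K + a₀ / (2 * q) ≤ Z * s - (Z * W + Real.pi * F + d * V) := by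
      have : Z * s - Z * W = Z * (s - W) := by ring
      linarith
    calc Real.pi * (K * I) = I * (Real.pi * K) := by ring
      _ < I * (Real.pi * K + a₀ / (2 * q)) := by
          apply mul_lt_mul_of_pos_left _ hI
          have h6 : 0 < a₀ / (2 * q) := by positivity
          linarith
      _ ≤ I * (Z * s - (Z * W + Real.pi * F + d * V)) := mul_le_mul_of_nonneg_left h5 hI.le
  calc Um ≤ N * (Real.pi * (K * I)) := hUm
    _ < N * (I * (Z * s - (Z * W + Real.pi * F + d * V))) := mul_lt_mul_of_pos_left hcore hN
    _ ≤ Up := hUp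

end Summit.RiemannHypothesis.RiemannHypothesis.Theorems.JensenPolynomials.LogBandArc

end
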